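import Summits.CriticalPhenomena.PercolationContinuityZ3.Theorems.PercNearOneGluingNoHeavyLowerTailBlockQ9OneDangerousPort
import HarnessLib

/-!
# `NoHeavyLowerTail` (stmt-CriticalPhenomena-4575) — the peeling CERTIFICATE for Kozma–Nitzan Question 9 on a
# glued one-layer block: step, transfer, and the two-port corollary

Support file (hull-port / coupling seat `prim-hp-1` gen 7; `--supports stmt-CriticalPhenomena-4575`).
No definitions, no named facts, no sorries.

Target inequality for a one-layer block `O` (no positive pair inside, every positive pair leaving `O` ends in `A`),
`a, b ∉ O`:   `Q9(w, a) :≡ μ_{glue_O w}(a ↔ b, O ↔ A) ≤ μ_{glue_O w}(O ↔ b)`.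

* `blockQ9_step` — PEELING STEP: if the port `v` hangs on `O` by the single pair `e = s(s₀,v)`, `a` is at most as
  connected to `b` as `v` in the UNGLUED graph `w`, and `Q9(w − e, a)` holds, then `Q9(w, a)` holds
  (`UpsetExchange.upsetExchange_block` on `{e open}`, `BlockQ9.real_inter_notMem_eq` on `{e closed}`).
* `blockQ9_of_transfer` — TERMINAL STEP by transfer: if `a'` is dominated in `kill_O w` by every port (so
  `Q9(w, a')` by `BlockQ9.blockThm4_witness`) and `μ_{glue_O w}(a ↔ b, O ↔ A) ≤ μ_{glue_O w}(a' ↔ b, O ↔ A)`, then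
  `Q9(w, a)`.
* `blockQ9_twoDangerousPorts` — the corollary with two peeled ports `v₁, v₂` (nested domination:
  `a ≤_w v₁`, `a ≤_{w − e₁} v₂`, the remaining ports dominate `a` in `kill_O w`).

Iterating `blockQ9_step` along any sequence of ports and finishing with `blockThm4_witness` / `blockQ9_of_transfer`
is the certificate of memo HULLPORT-COUPLING.md §48 (conjecture C′: for `a` dominated by every port in `w`, the
sequence "weakest admissible port first" always certifies — 0 failures in 7·10⁴ exact instances).
-/

namespace Summit.CriticalPhenomena.PercolationContinuityZ3.Theorems

open MeasureTheory Set ProbabilityTheory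
open Literature.Probability.LatticeModels
open Literature.Probability.Percolation

noncomputable section
open Classical

namespace BlockQ9

variable {n : ℕ}

/-- **Peeling step.**  One-layer block `O` with no positive internal pair, `a, b ∉ O`, a port `v ∉ O` attached
through the single pair `s(s₀, v)` (`s₀ ∈ O`), `μ_w(a ↔ b) ≤ μ_w(v ↔ b)` in the unglued graph, and the target
inequality for the weights with `s(s₀,v)` deleted.  Then the target inequality holds for `w`.
[cite: KozmaNitzan2024, Lemma 5 and Question 9 (pp. 13, 36)] -/
theorem blockQ9_step (w : Sym2 (Fin n) → unitInterval) (O A : Finset (Fin n)) (a b v s₀ : Fin n)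
    (hvO : v ∉ O) (hs₀ : s₀ ∈ O)
    (hO0 : ∀ e : Sym2 (Fin n), (∀ x ∈ e, x ∈ O) → ¬ e.IsDiag → w e = 0)
    (hyp : (prodBernoulli w).real (openConn a b) ≤ (prodBernoulli w).real (openConn v b))
    (IH : (prodBernoulli (fun e : Sym2 (Fin n) => if (∀ x ∈ e, x ∈ O) ∧ ¬ e.IsDiag then 1 else
          (if e = s(s₀, v) then 0 else w e))).real (openConn a b ∩ ⋃ o ∈ O, ⋃ x ∈ A, openConn o x) ≤
        (prodBernoulli (fun e : Sym2 (Fin n) => if (∀ x ∈ e, x ∈ O) ∧ ¬ e.IsDiag then 1 else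
          (if e = s(s₀, v) then 0 else w e))).real (⋃ o ∈ O, openConn o b)) :
    (prodBernoulli (fun e : Sym2 (Fin n) => if (∀ x ∈ e, x ∈ O) ∧ ¬ e.IsDiag then 1 else w e)).real
        (openConn a b ∩ ⋃ o ∈ O, ⋃ x ∈ A, openConn o x) ≤
      (prodBernoulli (fun e : Sym2 (Fin n) => if (∀ x ∈ e, x ∈ O) ∧ ¬ e.IsDiag then 1 else w e)).real
        (⋃ o ∈ O, openConn o b) := by
  classical
  set g : Sym2 (Fin n) → unitInterval := fun e => if (∀ x ∈ e, x ∈ O) ∧ ¬ e.IsDiag then 1 else w e with hg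
  set e₀ : Sym2 (Fin n) := s(s₀, v) with he₀
  have hsv : s₀ ≠ v := fun h => hvO (h ▸ hs₀)
  have he₀int : ¬ ((∀ x ∈ e₀, x ∈ O) ∧ ¬ e₀.IsDiag) := fun h => hvO (h.1 v (Sym2.mem_mk_right s₀ v))
  set w' : Sym2 (Fin n) → unitInterval := fun f => if f = e₀ then 0 else w f with hw'
  set g' : Sym2 (Fin n) → unitInterval := fun e => if (∀ x ∈ e, x ∈ O) ∧ ¬ e.IsDiag then 1 else w' e with hg'
  set U : Set (BondConfig (Fin n)) := ⋃ o ∈ O, ⋃ x ∈ A, openConn o x with hU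
  have hsplit : ∀ X : Set (BondConfig (Fin n)), (prodBernoulli g).real X =
      (prodBernoulli g).real (X ∩ {ω | e₀ ∈ ω}) + (prodBernoulli g).real (X ∩ {ω | e₀ ∉ ω}) := by
    intro X
    rw [← measureReal_inter_add_sdiff (s := X) (MeasurableSet.of_discrete : MeasurableSet {ω : BondConfig (Fin n) | e₀ ∈ ω})
      (h := measure_ne_top _ _)]
    rfl
  -- `{e₀ open}`: up-set exchange
  have hopen : (prodBernoulli g).real ((openConn a b ∩ U) ∩ {ω | e₀ ∈ ω}) ≤
      (prodBernoulli g).real ((⋃ o ∈ O, openConn o b) ∩ {ω | e₀ ∈ ω}) := by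
    have hC : ∀ e ∈ ({e₀} : Finset (Sym2 (Fin n))), ¬ e.IsDiag ∧ ∃ x ∈ e, x ∈ O := by
      intro e he
      rw [Finset.mem_singleton] at he
      subst he
      exact ⟨by rw [he₀, Sym2.mk_isDiag_iff]; exact hsv, s₀, Sym2.mem_mk_left s₀ v, hs₀⟩
    have hx := UpsetExchange.upsetExchange_block w O a b v s₀ hvO hs₀ hO0 {e₀} hC (Finset.mem_singleton_self _) hyp
    have hco : {ω : BondConfig (Fin n) | (↑({e₀} : Finset (Sym2 (Fin n))) : Set (Sym2 (Fin n))) ⊆ ω} = {ω | e₀ ∈ ω} := by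
      ext ω; simp
    rw [hco] at hx
    calc (prodBernoulli g).real ((openConn a b ∩ U) ∩ {ω | e₀ ∈ ω})
        ≤ (prodBernoulli g).real (openConn a b ∩ {ω | e₀ ∈ ω}) :=
          measureReal_mono fun ω ⟨⟨h1, _⟩, h2⟩ => ⟨h1, h2⟩
      _ ≤ (prodBernoulli g).real (openConn s₀ b ∩ {ω | e₀ ∈ ω}) := hx
      _ ≤ (prodBernoulli g).real ((⋃ o ∈ O, openConn o b) ∩ {ω | e₀ ∈ ω}) :=
          measureReal_mono fun ω ⟨h1, h2⟩ => ⟨mem_iUnion₂.2 ⟨s₀, hs₀, h1⟩, h2⟩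
  -- `{e₀ closed}`: delete `e₀` and use `IH`
  have hg'e₀ : g' e₀ = 0 := by simp only [hg', if_neg he₀int, hw', if_true]
  have hgg' : ∀ f, f ≠ e₀ → g f = g' f := by
    intro f hf
    simp only [hg, hg', hw', if_neg hf]
  have hclosedA := real_inter_notMem_eq g g' e₀ hg'e₀ hgg' (openConn a b ∩ U)
  have hclosedB := real_inter_notMem_eq g g' e₀ hg'e₀ hgg' (⋃ o ∈ O, openConn o b)
  have hIH : (prodBernoulli g').real (openConn a b ∩ U) ≤ (prodBernoulli g').real (⋃ o ∈ O, openConn o b) := IH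
  rw [hsplit (openConn a b ∩ U), hsplit (⋃ o ∈ O, openConn o b), hclosedA, hclosedB]
  have h1g : 0 ≤ 1 - (g e₀ : ℝ) := sub_nonneg.2 (g e₀).2.2
  nlinarith [mul_le_mul_of_nonneg_left hIH h1g]

/-- **Terminal step by transfer.**  One-layer block `O`, `a, a', b ∉ O`; `a'` is dominated in `kill_O w` by every
port (so Theorem 4 applies to `a'`), and `μ_{glue_O w}(a ↔ b, O ↔ A) ≤ μ_{glue_O w}(a' ↔ b, O ↔ A)`.  Then the
target inequality holds for `a`. [cite: KozmaNitzan2024, Thm. 4 (p. 12)] -/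
theorem blockQ9_of_transfer (w : Sym2 (Fin n) → unitInterval) (O A : Finset (Fin n)) (a a' b : Fin n)
    (hOA : Disjoint O A) (ha'O : a' ∉ O) (hbO : b ∉ O)
    (hiso : ∀ x ∈ O, ∀ y : Fin n, y ∉ O → y ∉ A → w s(x, y) = 0)
    (hdom : ∀ v ∈ A, (∃ o ∈ O, w s(o, v) ≠ 0) →
      (prodBernoulli (fun e : Sym2 (Fin n) => if (∃ x ∈ e, x ∈ O) then 0 else w e)).real (openConn a' b) ≤
        (prodBernoulli (fun e : Sym2 (Fin n) => if (∃ x ∈ e, x ∈ O) then 0 else w e)).real (openConn v b))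
    (hF : (prodBernoulli (fun e : Sym2 (Fin n) => if (∀ x ∈ e, x ∈ O) ∧ ¬ e.IsDiag then 1 else w e)).real
          (openConn a b ∩ ⋃ o ∈ O, ⋃ x ∈ A, openConn o x) ≤
        (prodBernoulli (fun e : Sym2 (Fin n) => if (∀ x ∈ e, x ∈ O) ∧ ¬ e.IsDiag then 1 else w e)).real
          (openConn a' b ∩ ⋃ o ∈ O, ⋃ x ∈ A, openConn o x)) :
    (prodBernoulli (fun e : Sym2 (Fin n) => if (∀ x ∈ e, x ∈ O) ∧ ¬ e.IsDiag then 1 else w e)).real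
        (openConn a b ∩ ⋃ o ∈ O, ⋃ x ∈ A, openConn o x) ≤
      (prodBernoulli (fun e : Sym2 (Fin n) => if (∀ x ∈ e, x ∈ O) ∧ ¬ e.IsDiag then 1 else w e)).real
        (⋃ o ∈ O, openConn o b) :=
  hF.trans (blockThm4_witness w O A a' b hOA ha'O hbO hiso hdom)

/-- **Two dangerous ports with nested domination.**  One-layer block `O` with no positive internal pair,
`a, b ∉ O`; ports `v₁ ≠ v₂` (not in `O`) attached through single pairs `s(s₁,v₁)`, `s(s₂,v₂)`; `a ≤ v₁` in the
unglued graph `w`, `a ≤ v₂` in `w` with `s(s₁,v₁)` deleted, and every other port dominates `a` in `kill_O w`.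
Then `μ_{glue_O w}(a ↔ b, O ↔ A) ≤ μ_{glue_O w}(O ↔ b)`. [cite: KozmaNitzan2024, Question 9 (p. 36)] -/
theorem blockQ9_twoDangerousPorts (w : Sym2 (Fin n) → unitInterval) (O A : Finset (Fin n))
    (a b v₁ s₁ v₂ s₂ : Fin n)
    (hOA : Disjoint O A) (haO : a ∉ O) (hbO : b ∉ O) (hv₁O : v₁ ∉ O) (hs₁ : s₁ ∈ O) (hv₂O : v₂ ∉ O)
    (hs₂ : s₂ ∈ O) (hv₁₂ : v₁ ≠ v₂)
    (hiso : ∀ x ∈ O, ∀ y : Fin n, y ∉ O → y ∉ A → w s(x, y) = 0)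
    (hO0 : ∀ e : Sym2 (Fin n), (∀ x ∈ e, x ∈ O) → ¬ e.IsDiag → w e = 0)
    (hv₁1 : ∀ o ∈ O, o ≠ s₁ → w s(o, v₁) = 0) (hv₂1 : ∀ o ∈ O, o ≠ s₂ → w s(o, v₂) = 0)
    (hyp₁ : (prodBernoulli w).real (openConn a b) ≤ (prodBernoulli w).real (openConn v₁ b))
    (hyp₂ : (prodBernoulli (fun e : Sym2 (Fin n) => if e = s(s₁, v₁) then 0 else w e)).real (openConn a b) ≤
      (prodBernoulli (fun e : Sym2 (Fin n) => if e = s(s₁, v₁) then 0 else w e)).real (openConn v₂ b))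
    (hdom : ∀ p ∈ A, p ≠ v₁ → p ≠ v₂ → (∃ o ∈ O, w s(o, p) ≠ 0) →
      (prodBernoulli (fun e : Sym2 (Fin n) => if (∃ x ∈ e, x ∈ O) then 0 else w e)).real (openConn a b) ≤
        (prodBernoulli (fun e : Sym2 (Fin n) => if (∃ x ∈ e, x ∈ O) then 0 else w e)).real (openConn p b)) :
    (prodBernoulli (fun e : Sym2 (Fin n) => if (∀ x ∈ e, x ∈ O) ∧ ¬ e.IsDiag then 1 else w e)).real
        (openConn a b ∩ ⋃ o ∈ O, ⋃ x ∈ A, openConn o x) ≤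
      (prodBernoulli (fun e : Sym2 (Fin n) => if (∀ x ∈ e, x ∈ O) ∧ ¬ e.IsDiag then 1 else w e)).real
        (⋃ o ∈ O, openConn o b) := by
  classical
  set w₁ : Sym2 (Fin n) → unitInterval := fun e => if e = s(s₁, v₁) then 0 else w e with hw₁
  refine blockQ9_step w O A a b v₁ s₁ hv₁O hs₁ hO0 hyp₁ ?_
  -- after deleting `s(s₁,v₁)`: one dangerous port `v₂` left
  have hne : s(s₂, v₂) ≠ s(s₁, v₁) := by
    intro h
    rcases Sym2.eq_iff.1 h with ⟨-, h2⟩ | ⟨h1, -⟩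
    · exact hv₁₂ h2.symm
    · exact hv₁O (h1 ▸ hs₂)  -- wait: h1 : s₂ = v₁ gives v₁ ∈ O
  have hkill : (fun e : Sym2 (Fin n) => if (∃ x ∈ e, x ∈ O) then (0 : unitInterval) else w₁ e) =
      fun e : Sym2 (Fin n) => if (∃ x ∈ e, x ∈ O) then 0 else w e := by
    funext f
    by_cases hf : ∃ x ∈ f, x ∈ O
    · rw [if_pos hf, if_pos hf]
    · rw [if_neg hf, if_neg hf]
      have : f ≠ s(s₁, v₁) := fun h => hf ⟨s₁, h ▸ Sym2.mem_mk_left s₁ v₁, hs₁⟩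
      simp only [hw₁, if_neg this]
  refine blockQ9_oneDangerousPort w₁ O A a b v₂ s₂ hOA haO hbO hv₂O hs₂ (fun x hx y hyO hyA => ?_)
    (fun e he hed => ?_) (fun o ho hos => ?_) (fun p hp hpv₂ hport => ?_) hyp₂
  · simp only [hw₁]
    split_ifs
    · rfl
    · exact hiso x hx y hyO hyA
  · simp only [hw₁]
    split_ifs
    · rfl
    · exact hO0 e he hed
  · simp only [hw₁]
    split_ifs
    · rfl
    · exact hv₂1 o ho hos
  · obtain ⟨o, ho, hwo⟩ := hport
    have hne' : s(o, p) ≠ s(s₁, v₁) := fun h => by apply hwo; simp only [hw₁, if_pos h]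
    have hwo' : w s(o, p) ≠ 0 := by simpa only [hw₁, if_neg hne'] using hwo
    have hpv₁ : p ≠ v₁ := by
      rintro rfl
      by_cases hos : o = s₁
      · exact hne' (by rw [hos])
      · exact hwo' (hv₁1 o ho hos)
    rw [hkill]
    exact hdom p hp hpv₁ hpv₂ ⟨o, ho, hwo'⟩

end BlockQ9

end

end Summit.CriticalPhenomena.PercolationContinuityZ3.Theorems
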